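import Summits.HodgeConjecture.HodgeConjecture.Theorems.VHCAbelianSchemesRoadDiagonalSingleCell
import HarnessLib

/-!
# Road b02 (`VHCAbelianSchemesRoad`, D-0059) — under `HC_CM`, HC for abelian `g`-folds needs regime K-SR♭∃ at ONE diagonal cell
# `(2M, M)`, any `M ≥ 2g − 2` (part X-d needed the window of cells `g + 2 ≤ m ≤ 2g − 2`)

research route conditional on HC_CM; not a corollary; Q11.4-sentence-2 already refuted in dim ≥ 3.
(cell line of seat ab-andre-2: research route, not a corollary; conditional on HC_CM plus one named minimal statement.)

THEOREMS ONLY (no definition, no named fact, no sorry; `HC_CM` — as `Milne1999.CMHodgeHypothesisAt` at ONE dimension, or the cell's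
`Theses.RankFourFaces.CMAbelianHodge` — is an explicit ARGUMENT wherever used; no cell of the crux is claimed). Seat ab-andre-2
gen 56, PART Y-c (sequel of parts Y-a/Y-b: pure padding, the single-cell engine above the threshold).

WHAT THIS FILE PROVES. Part X-b (`VHCAbelianSchemesRoadDiagonalCM.lean`, p449674) and part X-d (`…DiagonalCell.lean`, p450442)
derived `HCAtDim g` — the Hodge conjecture for complex abelian varieties of dimension `g` — from André's Lemme 6.3.1, `HC_CM` at
dimension `2g`, the door, the curve residual and the graded crux at the WINDOW of diagonal cells `g + 2 ≤ m ≤ 2g − 2` (one cell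
`m = 2g − p` per codimension `2 ≤ p ≤ g − 2` of the class on the pencil of relative dimension `2g`). With part Y-b's single-cell
engine ABOVE the threshold (`not_countable_algebraicityLocus_of_cellAbove`: any `m ≥ max(p, n − p)` serves `(n, p)`), ONE cell
serves the whole window:
* §1–§2 at fixed relative dimension `n`: VHC on every fibre of every one-parameter abelian scheme of relative dimension `n`
  (then of every abelian-fibred family of relative dimension `n` with a section over a smooth irreducible base, then of every
  compact pencil) from the door and ONE cell `(2M, M)` with `M + 2 ≥ n` (off the middle range the fibres are divisorial, part W).
* §3 per abelian variety / per dimension: `HodgeConjectureFor A` ⟸ Lemme 6.3.1 + `HC_CM` at `2·dim A` + door + curve residual +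
  ONE cell `M ≥ 2·dim A − 2`; `HCAtDim g` likewise with `M ≥ 2g − 2`. Instances: abelian FOURFOLDS from `HC_CM` at dimension 8
  and the cell `(12, 6)`; SIXFOLDS from `HC_CM` at dimension 12 and the cell `(20, 10)` (part X-d: the five cells `(12,6)…(20,10)`).
* §4 the same over the road's TWISTED door (regime 2 at one cell, K-C, the twisted door, Raynaud).
For `HC_AV` as a whole `HC_CM` buys nothing on this road (part Y-b: infinitely many cells suffice WITHOUT it, and are still needed
with it — one above `2g − 2` for every `g`); what `HC_CM` buys is «one cell per dimension» in place of the unbounded second-level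
pencils of Lemmes 6.3.2–6.3.3. NOT claimed: any cell; anything about which cell is easiest; the converse.

References: [Andre1996Motifs] Lemme 6.3.1 (p. 31), §6.3 a) (p. 33); [Abdulali1994FamiliesAV] Lemma 6.2; [Milne1999] §7;
[BrosnanFangNiePearlstein2009] §6 Lemma 48; [Fulton1998] §10.1 Cor. 10.1; [Lieberman1968]; [CharlesSchnell2014Notes] Prop. 11.3.11,
Cor. 11.3.6; [VoisinHodgeII2003] §7.3.2; [VoisinHodgeI2002] Thm. 11.30; [MumfordAV1970] §6; [GortzWedhorn2023] Thm. 27.291.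
-/

noncomputable section

open CategoryTheory CategoryTheory.Limits AlgebraicGeometry Topology MonoidalCategory CartesianMonoidalCategory

namespace Summit.HodgeConjecture.HodgeConjecture.Ring2.SemiregularRepresentatives

set_option linter.dupNamespace false -- the cell's namespace repeats the summit name, as in every `Ring2*` file

open Literature.AlgebraicGeometry Literature.AlgebraicGeometry.Motives Literature.AlgebraicGeometry.HodgeTheory
open Literature.AlgebraicTopology.SingularHomology
open Literature.AlgebraicGeometry.Andre1996 (andre1996_cmAnchoredPencil IsCMAnchoredPencilFor compactPencil_dim_eq_of_iso
  compactPencil_irreducibleSpace_base compactPencil_smooth_base compactPencil_exists_abelianVariety_fiber_dim)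
open Literature.AlgebraicGeometry.Milne1999 (CMHodgeHypothesisAt)
open Summit.Ventures.HSemireg (ObjClass LocalVariationalHodgeFor)
open Summit.HodgeConjecture.HodgeConjecture.Ring2.Hypotheses (AbelianSchemeVHC)
open Summit.HodgeConjecture.HodgeConjecture.Ring2.Binders
open Summit.HodgeConjecture.HodgeConjecture.Ring2.ClassTargets

variable {𝒳 S : SchemeOver ℂ}

/-! ## §1 VHC on every fibre at fixed relative dimension `n` from the door and ONE cell `(2M, M)`, `M + 2 ≥ n` -/

/-- **VHC ON EVERY FIBRE of a one-parameter abelian scheme of relative dimension `n`** (affine curve base, section, quasi-projective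
total space) **from the door and ONE diagonal cell `(2M, M)` with `M + 2 ≥ n`**, in EVERY codimension: off the middle range every
fibre is divisorial hence algebraic (part W's `mem_algebraicClasses_and_divisorClassesSpan_of_offMidRange`); in the middle range
`2 ≤ p ≤ n − 2` one has `max(p, n − p) ≤ n − 2 ≤ M`, so part Y-b's single-cell engine makes the locus uncountable, hence thick, hence
everything (`Theorems.mem_algebraicClasses_of_thickSet`, relative Hilbert schemes). [cite: CharlesSchnell2014Notes, Prop. 11.3.11 (proof)]
[cite: VoisinHodgeII2003, §7.3.2] [cite: VoisinHodgeI2002, Thm. 11.30] [cite: BrosnanFangNiePearlstein2009, §6 Lemma 48] -/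
theorem forall_mem_algebraicClasses_oneParameter_of_cellAbove {𝒪 : ObjClass} (hT : LocalVariationalHodgeFor 𝒪) {n M : ℕ}
    (hM : n ≤ M + 2) (hSR : AdmissibleRepresentativesLefAtDeg 𝒪 (2 * M) M)
    (f : 𝒳 ⟶ S) (hf : IsSmoothProjectiveFamily f n) (h𝒳 : IsQuasiProjectiveOver 𝒳)
    [IrreducibleSpace S.left] [IsAffine S.left] [AlgebraicGeometry.Smooth S.hom] (hdim : topologicalKrullDim S.left = 1)
    (habel : ∀ s : ComplexPoints S, ∃ A' : AbelianVariety ℂ, A'.dim = n ∧ Nonempty (A'.X ≅ fiberOver f s))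
    (he : ∃ e : S ⟶ 𝒳, e ≫ f = 𝟙 S) (p : ℕ) (W : complexBetti 𝒳 (2 * p))
    (hW : ∀ s : ComplexPoints S, IsRationalClass (complexBetti.map (fiberι f s) (2 * p) W) ∧
      IsOfHodgeType n (fiberOver f s) (2 * p) p p (complexBetti.map (fiberι f s) (2 * p) W))
    {s₀ : ComplexPoints S} (hs₀ : complexBetti.map (fiberι f s₀) (2 * p) W ∈ algebraicClasses (fiberOver f s₀) p)
    (s : ComplexPoints S) : complexBetti.map (fiberι f s) (2 * p) W ∈ algebraicClasses (fiberOver f s) p := by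
  haveI : LocallyOfFiniteType S.hom := inferInstance
  by_cases hoff : p ≤ 1 ∨ n ≤ p + 1
  · exact (mem_algebraicClasses_and_divisorClassesSpan_of_offMidRange (hf.isSmoothProjective s) hoff _ (hW s).1 (hW s).2).1
  · exact Theorems.mem_algebraicClasses_of_thickSet charlesSchnell_algebraicityLocus_iUnion_closed_holds f hf h𝒳
      (IsQuasiProjectiveOver.of_isAffine S) ‹_› W
      {t : ComplexPoints S | complexBetti.map (fiberι f t) (2 * p) W ∈ algebraicClasses (fiberOver f t) p}
      (curve_not_subset_iUnion_of_not_countable hdim _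
        (not_countable_algebraicityLocus_of_cellAbove hT hSR f hf h𝒳 hdim habel he (by omega) (by omega) W hW hs₀))
      (fun t ht => ht) s

/-! ## §2 From one-parameter abelian schemes to every base with a section and to compact pencils, at fixed `n` -/

/-- **VHC on every abelian-fibred family OF RELATIVE DIMENSION `n` WITH A SECTION over a smooth irreducible base, from the door, ONE
cell `(2M, M)` with `M + 2 ≥ n` and the curve residual** (part X-b §2 verbatim with the window replaced by the cell: the
AnchorTransport curve reduction for the base-change-stable class «fibres abelian of dimension `n` ∧ a section exists», Mumford's
curve through two points, the dimension clause pinning `n`). [cite: MumfordAV1970, §6 Lemma]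
[cite: CharlesSchnell2014Notes, Prop. 11.3.11 (proof)] [cite: GortzWedhorn2023, Thm. 27.291] -/
theorem forall_mem_algebraicClasses_of_cellAbove_of_section {𝒪 : ObjClass} (hT : LocalVariationalHodgeFor 𝒪) {n M : ℕ}
    (hM : n ≤ M + 2) (hSR : AdmissibleRepresentativesLefAtDeg 𝒪 (2 * M) M)
    (hqp : OneParameterAbelianSchemeQuasiProjective) (f : 𝒳 ⟶ S) (hf : IsSmoothProjectiveFamily f n)
    (hirr : IrreducibleSpace S.left) (hsm : AlgebraicGeometry.Smooth S.hom)
    (habel : ∀ s : ComplexPoints S, ∃ A' : AbelianVariety ℂ, A'.dim = n ∧ Nonempty (A'.X ≅ fiberOver f s))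
    (he : ∃ e : S ⟶ 𝒳, e ≫ f = 𝟙 S) (p : ℕ) (W : complexBetti 𝒳 (2 * p))
    (hW : ∀ s : ComplexPoints S, IsRationalClass (complexBetti.map (fiberι f s) (2 * p) W) ∧
      IsOfHodgeType n (fiberOver f s) (2 * p) p p (complexBetti.map (fiberι f s) (2 * p) W))
    (hs₀ : ∃ s₀ : ComplexPoints S, complexBetti.map (fiberι f s₀) (2 * p) W ∈ algebraicClasses (fiberOver f s₀) p)
    (s : ComplexPoints S) : complexBetti.map (fiberι f s) (2 * p) W ∈ algebraicClasses (fiberOver f s) p := by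
  refine Theorems.variationalHodge_of_curveBase_of_stable mumford_smoothCurve_through_two_points_holds
    (fun 𝒳' S' f' => (∀ s' : ComplexPoints S', ∃ A' : AbelianVariety ℂ, A'.dim = n ∧ Nonempty (A'.X ≅ fiberOver f' s')) ∧
      ∃ e' : S' ⟶ 𝒳', e' ≫ f' = 𝟙 S')
    (fun 𝒳' S' S'' f' g hQ => ⟨fun s' => ?_, exists_section_familyPullback f' g hQ.2⟩)
    (fun n' 𝒳' S' f' hf' hQ hirr' haff' hsm' hdim' p' A hA hA₀ s' => ?_) f hf ⟨habel, he⟩ hirr hsm p W hW hs₀ s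
  · obtain ⟨A', hd, ⟨e⟩⟩ := hQ.1 (AlgPoints.map g s')
    exact ⟨A', hd, ⟨e ≪≫ (fiberOverFamilyPullbackIso f' g s').symm⟩⟩
  · obtain ⟨s₀', hs₀'⟩ := hA₀
    obtain ⟨A', hd, ⟨e⟩⟩ := hQ.1 s₀'
    have hn : n' = n := (dim_eq_of_iso_fiberOver hf' e).symm.trans hd
    subst hn
    haveI := hirr'
    haveI := haff'
    haveI := hsm'
    exact forall_mem_algebraicClasses_oneParameter_of_cellAbove hT hM hSR f' hf' (hqp f' hf' hirr' haff' hsm' hdim' hQ.1 hQ.2)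
      hdim' hQ.1 hQ.2 p' A hA hs₀' s'

/-- **VHC on every COMPACT pencil of abelian varieties of relative dimension `n`** (André's «pinceau compact»; they carry a section)
from the door, ONE cell `(2M, M)` with `M + 2 ≥ n` and the curve residual — Abdulali's `InvariantCyclesHoldFor f n`.
[cite: Andre1996Motifs, §6.3 footnote (2) and Lemme 6.3.1] [cite: Abdulali1994FamiliesAV, (1.1) (p. 1122)] [cite: MumfordAV1970, §6 Lemma] -/
theorem invariantCyclesHoldFor_compactPencil_of_cellAbove {𝒪 : ObjClass} (hT : LocalVariationalHodgeFor 𝒪) {n M : ℕ}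
    (hM : n ≤ M + 2) (hSR : AdmissibleRepresentativesLefAtDeg 𝒪 (2 * M) M)
    (hqp : OneParameterAbelianSchemeQuasiProjective) {f : 𝒳 ⟶ S} (hf : IsCompactAbelianPencil f n) :
    Literature.AlgebraicGeometry.Abdulali1994.InvariantCyclesHoldFor f n :=
  fun p W hW hs₀ s => forall_mem_algebraicClasses_of_cellAbove_of_section hT hM hSR hqp f hf.isSmoothProjectiveFamily
    (compactPencil_irreducibleSpace_base hf) (compactPencil_smooth_base hf) (compactPencil_exists_abelianVariety_fiber_dim hf)
    hf.exists_section p W hW hs₀ s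

/-! ## §3 Per abelian variety and per dimension: Lemme 6.3.1 + `HC_CM` at `2g` + ONE cell `M ≥ 2g − 2` -/

/-- **HC for ONE abelian variety `A` of dimension `g` from Lemme 6.3.1, `HC_CM` AT DIMENSION `2g`, the door, the curve residual and
the graded crux at ONE diagonal cell `(2M, M)`, any `M ≥ 2g − 2`** (part X-b's `hodgeConjectureFor_of_HC_CM_of_cmAnchoredPencil_of_window`
with the window `g ≤ m ≤ 2g − 2` replaced by one cell above it): codimensions `p ≤ 1`, `p ≥ g − 1` are divisorial; otherwise Lemme
6.3.1's compact pencil of relative dimension `2g` through `q·c` with a CM fibre, `HC_CM` there, §2 along the pencil, `e₁` and `g` back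
to `A`. [cite: Andre1996Motifs, Lemme 6.3.1 (p. 31) and §6.3 a) (p. 33)] [cite: Abdulali1994FamiliesAV, Lemma 6.2 (p. 1131)]
[cite: Milne1999, §7 p. 72] -/
theorem hodgeConjectureFor_of_HC_CM_of_cmAnchoredPencil_of_cellAbove (h₂₁ : andre1996_cmAnchoredPencil) {𝒪 : ObjClass}
    (hT : LocalVariationalHodgeFor 𝒪) (hqp : OneParameterAbelianSchemeQuasiProjective) (A : AbelianVariety ℂ)
    (hCM : ∀ A₀ : AbelianVariety ℂ, A₀.dim = 2 * A.dim → CMHodgeHypothesisAt A₀)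
    {M : ℕ} (hM : 2 * A.dim ≤ M + 2) (hSR : AdmissibleRepresentativesLefAtDeg 𝒪 (2 * M) M) :
    HodgeConjectureFor A.dim A.X := by
  have hA : IsSmoothProjective A.dim A.X := AbelianVariety.isSmoothProjective_holds
  refine (hodgeConjectureFor_iff_of_isSmoothProjective nonempty_hodgeModel_holds hA).2 ?_
  intro p c hc hpp
  by_cases hoff : p ≤ 1 ∨ A.dim ≤ p + 1
  · exact (mem_algebraicClasses_and_divisorClassesSpan_of_offMidRange hA hoff c hc hpp).1
  obtain ⟨𝒳, S, f, hf, s, t, W, A₁, A₀, e₁, g, q, hW, hq, hgc, ⟨e₀⟩, hA₀⟩ := h₂₁ A hA p c hc hpp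
  -- the CM fibre `𝒳_t ≅ A₀.X`: `A₀` is smooth projective of dimension `dim A₀ = 2 dim A`
  have hA₀sp : IsSmoothProjective A₀.dim A₀.X := AbelianVariety.isSmoothProjective_holds
  have hdim : A₀.dim = 2 * A.dim := compactPencil_dim_eq_of_iso hf e₀
  -- `HC_CM` at `A₀`, moved to the fibre `𝒳_t` along `e₀`
  have h₀ : complexBetti.map (fiberι f t) (2 * p) W ∈ algebraicClasses (fiberOver f t) p := by
    have hHC := (hCM A₀ hdim hA₀sp hA₀).2 p
    rw [hdim] at hHC
    exact (forall_hodgeClass_mem_algebraicClasses_iff_of_iso e₀ p).1 hHC _ (hW t).1 (hW t).2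
  -- transport along the pencil (relative dimension `2 dim A`) from `t` to `s`: ONE cell `M ≥ 2 dim A - 2`
  have h₁ := invariantCyclesHoldFor_compactPencil_of_cellAbove hT (n := 2 * A.dim) hM hSR hqp hf p W hW ⟨t, h₀⟩ s
  have h₂ : complexBetti.map e₁.hom (2 * p) (complexBetti.map (fiberι f s) (2 * p) W) ∈ algebraicClasses A₁.X p :=
    (mem_algebraicClasses_map_iff_of_iso e₁).2 h₁
  have h₃ : (q : ℂ) • c ∈ algebraicClasses A.X p := by
    rw [← hgc]
    exact map_mem_algebraicClasses_of_abelianVariety hA A₁ g.hom.hom.hom h₂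
  exact (Submodule.smul_mem_iff _ (Rat.cast_ne_zero.2 hq)).1 h₃

/-- **`HCAtDim g` — HC for complex abelian varieties of dimension `g` — from Lemme 6.3.1, `HC_CM` at dimension `2g`, the door, the
curve residual and the graded crux at ONE diagonal cell `(2M, M)`, any `M ≥ 2g − 2`.** For `g = 6`: `HC_CM` at dimension 12 and the
single cell `(20, 10)` (or `(22, 11)`, or …) — part X-d needed the five cells `(12, 6), …, (20, 10)`.
[cite: Andre1996Motifs, Lemme 6.3.1 (p. 31) and §6.3 a) (p. 33)] [cite: Abdulali1994FamiliesAV, Lemma 6.2 (p. 1131)] -/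
theorem hcAtDim_of_HC_CM_of_lefAtDeg_cellAbove (g : ℕ) (h₂₁ : andre1996_cmAnchoredPencil) {𝒪 : ObjClass}
    (hT : LocalVariationalHodgeFor 𝒪) (hqp : OneParameterAbelianSchemeQuasiProjective)
    (hCM : ∀ A₀ : AbelianVariety ℂ, A₀.dim = 2 * g → CMHodgeHypothesisAt A₀)
    {M : ℕ} (hM : 2 * g ≤ M + 2) (hSR : AdmissibleRepresentativesLefAtDeg 𝒪 (2 * M) M) : HCAtDim g := by
  intro A hAg
  have hg : A.dim = g := hAg
  exact hodgeConjectureFor_of_HC_CM_of_cmAnchoredPencil_of_cellAbove h₂₁ hT hqp A (fun A₀ h₀ => hCM A₀ (by rw [h₀, hg]))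
    (by omega) hSR

/-- **HC for complex abelian FOURFOLDS from `HC_CM` at dimension 8, Lemme 6.3.1, the door, the curve residual and the SINGLE cell
`(12, 6)` of the graded crux** (`g = 4`, `M = 6 = 2g − 2`). In print HC for abelian fourfolds is known only modulo Markman 2025
(UNREFEREED) + Moonen–Zarhin; nothing here uses it. [cite: Andre1996Motifs, Lemme 6.3.1 (p. 31)] [cite: Abdulali1994FamiliesAV, Lemma 6.2] -/
theorem hcAtDim_four_of_HC_CM_eight_of_cell_twelve_six (h₂₁ : andre1996_cmAnchoredPencil) {𝒪 : ObjClass}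
    (hT : LocalVariationalHodgeFor 𝒪) (hqp : OneParameterAbelianSchemeQuasiProjective)
    (hCM : ∀ A₀ : AbelianVariety ℂ, A₀.dim = 8 → CMHodgeHypothesisAt A₀)
    (hSR : AdmissibleRepresentativesLefAtDeg 𝒪 12 6) : HCAtDim 4 :=
  hcAtDim_of_HC_CM_of_lefAtDeg_cellAbove 4 h₂₁ hT hqp hCM (M := 6) (by norm_num) hSR

/-- **HC for complex abelian SIXFOLDS from `HC_CM` at dimension 12, Lemme 6.3.1, the door, the curve residual and the SINGLE cell
`(20, 10)` of the graded crux** (`g = 6`, `M = 10 = 2g − 2`). [cite: Andre1996Motifs, Lemme 6.3.1 (p. 31)] [cite: Abdulali1994FamiliesAV, Lemma 6.2] -/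
theorem hcAtDim_six_of_HC_CM_twelve_of_cell_twenty_ten (h₂₁ : andre1996_cmAnchoredPencil) {𝒪 : ObjClass}
    (hT : LocalVariationalHodgeFor 𝒪) (hqp : OneParameterAbelianSchemeQuasiProjective)
    (hCM : ∀ A₀ : AbelianVariety ℂ, A₀.dim = 12 → CMHodgeHypothesisAt A₀)
    (hSR : AdmissibleRepresentativesLefAtDeg 𝒪 20 10) : HCAtDim 6 :=
  hcAtDim_of_HC_CM_of_lefAtDeg_cellAbove 6 h₂₁ hT hqp hCM (M := 10) (by norm_num) hSR

/-! ## §4 Over the road's TWISTED door: regime 2 at ONE cell -/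

/-- **`HCAtDim g` over the twisted door from regime 2 at ONE diagonal cell `(2M, M)`, `M ≥ 2g − 2`**, K-C, the twisted door, Raynaud,
Lemme 6.3.1 and `HC_CM` at dimension `2g` (regime 1 at the cell holds by the null datum). [cite: Andre1996Motifs, Lemme 6.3.1 (p. 31)]
[cite: Pridham2024Semiregularity, Cor. 2.25 and Rem. 2.27] [cite: GortzWedhorn2023, Thm. 27.291] [cite: vanGeemen1994HodgeAV, §2.4] -/
theorem hcAtDim_of_HC_CM_of_exceptionalRegimeAt_twisted_cellAbove (hC : ChernCharacterOnBetti)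
    {Adm : PerfectAdmissibility} (hAdm : ∀ n X₀ I E, bfSingleAdmissible n X₀ I E → Adm n X₀ I E) (g : ℕ) {M : ℕ}
    (hM : 2 * g ≤ M + 2) (hcell : ∀ C : ChernCharacterBetti, LefAtExceptionalRegimeAt (twistedReflexiveClass C Adm) (2 * M) M)
    (hDoor : ∀ C : ChernCharacterBetti, TwistedPerfectDoorVHC C Adm)
    (hR : raynaud1970_abelianScheme_section_projective) (h₂₁ : andre1996_cmAnchoredPencil)
    (hCM : ∀ A₀ : AbelianVariety ℂ, A₀.dim = 2 * g → CMHodgeHypothesisAt A₀) : HCAtDim g := by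
  obtain ⟨C⟩ := hC
  exact hcAtDim_of_HC_CM_of_lefAtDeg_cellAbove g h₂₁ (𝒪 := twistedReflexiveClass C Adm) (hDoor C)
    (oneParameterAbelianSchemeQuasiProjective_of_raynaud1970 hR) hCM hM
    (admissibleRepresentativesLefAtDeg_twisted_of_exceptionalRegimeAt C hAdm (hcell C))

/-- **`HC_AV` over the twisted door from `HC_CM` and ONE CELL PER DIMENSION**: a choice `M g ≥ 2g − 2` of one diagonal cell for every
`g`, K-C, the twisted door, Raynaud, Lemme 6.3.1 and the cell's `HC_CM` (`Theses.RankFourFaces.CMAbelianHodge`). The cells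
`{(2·M g, M g)}` form an infinite set, so part Y-b already gives `HC_AV` from them WITHOUT `HC_CM`: on this road `HC_CM` is idle for
`HC_AV` and buys only the per-dimension statements of §3. [cite: Andre1996Motifs, Lemme 6.3.1 (p. 31) and §6.3 a) (p. 33)]
[cite: Abdulali1994FamiliesAV, Lemma 6.2] [cite: GortzWedhorn2023, Thm. 27.291] -/
theorem hc_av_of_HC_CM_of_exceptionalRegimeAt_twisted_cellPerDim (hC : ChernCharacterOnBetti)
    {Adm : PerfectAdmissibility} (hAdm : ∀ n X₀ I E, bfSingleAdmissible n X₀ I E → Adm n X₀ I E)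
    (hCM : Theses.RankFourFaces.CMAbelianHodge) (M : ℕ → ℕ) (hM : ∀ g, 2 * g ≤ M g + 2)
    (hcell : ∀ (C : ChernCharacterBetti) (g : ℕ), LefAtExceptionalRegimeAt (twistedReflexiveClass C Adm) (2 * M g) (M g))
    (hDoor : ∀ C : ChernCharacterBetti, TwistedPerfectDoorVHC C Adm)
    (hR : raynaud1970_abelianScheme_section_projective) (h₂₁ : andre1996_cmAnchoredPencil) :
    Theses.PadicSemiregularLift.HodgeAbelianVarieties :=
  hodgeAbelianVarieties_iff_forall_hcAtDim.2 fun g =>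
    hcAtDim_of_HC_CM_of_exceptionalRegimeAt_twisted_cellAbove hC hAdm g (hM g) (fun C => hcell C g) hDoor hR h₂₁
      fun A₀ _ => hCM A₀

/-! ## Audit: fact-free apart from the explicit hypotheses (closures are the three standard axioms) -/

#print axioms Summit.HodgeConjecture.HodgeConjecture.Ring2.SemiregularRepresentatives.hcAtDim_of_HC_CM_of_lefAtDeg_cellAbove
#print axioms Summit.HodgeConjecture.HodgeConjecture.Ring2.SemiregularRepresentatives.hc_av_of_HC_CM_of_exceptionalRegimeAt_twisted_cellPerDim

end Summit.HodgeConjecture.HodgeConjecture.Ring2.SemiregularRepresentatives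

end
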